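import Summits.Ventures.CertifiedArithmetic.LowPrec.DoubleRoundingSqrtUnderflowStrip

/-!
# Below the underflow clause of the square root, IV: the toy table in the kernel

HONEST FRAMING: certified error envelopes and provably optimal rounding/accumulation schemes for
low-precision formats under stated cost models; every table by two implementations; no hardware or
vendor claims.

Implementation B of the toy table of DOUBLE-ROUNDING-SQRT.md §5/§9 (implementation A:
`code/enum/sqrt_underflow_law.py`, certificate `certs/enum/DOUBLE-ROUNDING-SQRT-UNDERFLOW.json`):
the 28 pairs e2m1 → ⟨5,b,12,31⟩ (`b < 8`), e2m3 → ⟨9,b,14,511⟩ (`b < 10`), e3m2 → ⟨7,b,14,127⟩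
(`2 ≤ b < 12`) with, per pair, the depth `d = L_X - L_Y`, `F_X ⊆ F_Y`, the underflow clause (U)
of THEOREM D-sqrt, the depth test of THEOREM D-sqrt-U′ (= [Roux2014, Table II] disjunct 1 on
records), the shallow test of LAW N-sqrt-U′ and
`DRSqrt` by exhaustion of the source — all by `decide +kernel` — plus the two symbolic readings
`DRSqrt e2m3 ⟨9,b,14,511⟩ ↔ b ≥ 1` (`b ≤ 12`) and `DRSqrt e2m1 ⟨5,b,12,31⟩ ↔ b ≥ 1` (`b ≤ 10`).
[this packet]
-/

namespace Summit.Ventures.CertifiedArithmetic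

open Literature.ComputerArithmetic.FloatingPoint
open Literature.ComputerArithmetic.FloatingPoint.Format
open Literature.ComputerArithmetic.FloatingPoint.MiniFloat

/-! ## §6 The toy records around the underflow clause -/

/-- The toy wide record `⟨5, b, 12, 31⟩` of DOUBLE-ROUNDING-SQRT.md §5 (for e2m1). -/
def sqrtToy5 (b : ℕ) : Format := ⟨5, b, 12, 31, by decide⟩

/-- The toy wide record `⟨9, b, 14, 511⟩` of DOUBLE-ROUNDING-SQRT.md §5 (for e2m3). -/
def sqrtToy9 (b : ℕ) : Format := ⟨9, b, 14, 511, by decide⟩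

/-- The toy wide record `⟨7, b, 14, 127⟩` of DOUBLE-ROUNDING-SQRT.md §5 (for e3m2). -/
def sqrtToy7 (b : ℕ) : Format := ⟨7, b, 14, 127, by decide⟩

/-- The 28 toy pairs (source, wide record), in the order of the §5 table. -/
def sqrtToyPairs : List (Format × Format) :=
  (List.range 8).map (fun b => (E2M1, sqrtToy5 b)) ++
    (List.range 10).map (fun b => (E2M3, sqrtToy9 b)) ++
    (List.range 10).map (fun b => (E3M2, sqrtToy7 (b + 2)))

/-- THE TOY TABLE IN THE KERNEL (implementation B of DOUBLE-ROUNDING-SQRT.md §5/§9): per pair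
`(d, F_X ⊆ F_Y, (U), depth test, shallow test, DRSqrt by exhaustion)` with `d = L_X - L_Y`. Of the
28 pairs, 27 are embedded; (U) holds on 22, the depth test of THEOREM D-sqrt-U′ on 24 (the two
e2m3 columns of bias 1, 2 — `d = 6, 7` — and e2m1 bias 1 — `d = 4` — hold by the depth test while
(U) fails), the shallow test of LAW N-sqrt-U′ on the 2 failing pairs (`d = m + 2`, bias 1), and
2 pairs are decided by exhaustion only (e3m2 → ⟨7,2,…⟩: bias 3, `d = 4 = m + 2`, innocuous; e3m2 →
⟨7,11,…⟩: ranges not nested). Same 28 rows as implementation A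
(`code/enum/sqrt_underflow_law.py`, certificate DOUBLE-ROUNDING-SQRT-UNDERFLOW.json).
[this packet] -/
theorem sqrtToyPairs_table :
    sqrtToyPairs.map (fun p => ((p.1.qexp - p.2.qexp).toNat, embedsTest p.1 p.2,
      decide (2 * (p.2.qexp + (p.2.manBits : ℤ)) ≤ p.1.qexp), drSqrtDeepTest p.1 p.2,
      drSqrtShallowAny p.1 p.2, drSqrtExh p.1 p.2)) =
    [(3, true, false, false, true, false),
    (4, true, false, true, false, true),
    (5, true, true, true, false, true),
    (6, true, true, true, false, true),
    (7, true, true, true, false, true),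
    (8, true, true, true, false, true),
    (9, true, true, true, false, true),
    (10, true, true, true, false, true),
    (5, true, false, false, true, false),
    (6, true, false, true, false, true),
    (7, true, false, true, false, true),
    (8, true, true, true, false, true),
    (9, true, true, true, false, true),
    (10, true, true, true, false, true),
    (11, true, true, true, false, true),
    (12, true, true, true, false, true),
    (13, true, true, true, false, true),
    (14, true, true, true, false, true),
    (4, true, false, false, false, true),
    (5, true, true, true, false, true),
    (6, true, true, true, false, true),
    (7, true, true, true, false, true),
    (8, true, true, true, false, true),
    (9, true, true, true, false, true),
    (10, true, true, true, false, true),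
    (11, true, true, true, false, true),
    (12, true, true, true, false, true),
    (13, false, true, false, false, true)] := by
  decide +kernel

/-- Hence, on the toy pairs: the depth test and exhaustion agree wherever the depth test fires, the
shallow test fires exactly on the failing pairs, and `DRSqrt` holds on 26 of 28. [this packet] -/
theorem sqrtToyPairs_counts :
    (sqrtToyPairs.filter fun p => drSqrtDeepTest p.1 p.2).length = 24 ∧
    (sqrtToyPairs.filter fun p => drSqrtShallowAny p.1 p.2).length = 2 ∧
    (sqrtToyPairs.filter fun p => drSqrtExh p.1 p.2).length = 26 ∧
    (sqrtToyPairs.filter fun p => decide (2 * (p.2.qexp + (p.2.manBits : ℤ)) ≤ p.1.qexp)).length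
      = 22 ∧
    (sqrtToyPairs.all fun p => (!drSqrtDeepTest p.1 p.2 || drSqrtExh p.1 p.2) &&
      (!drSqrtShallowAny p.1 p.2 || !drSqrtExh p.1 p.2)) = true := by
  refine ⟨?_, ?_, ?_, ?_, ?_⟩ <;> decide +kernel

/-- READING. e2m3 through the toy binary records `⟨9, b, 14, 511⟩` (`P = 10 = 2·4 + 2`; `F_e2m3 ⊆
F_⟨9,b,14,511⟩` iff `b ≤ 12`): the square root is innocuous iff `b ≥ 1`, i.e. iff
`d = 5 + b ≥ m + 3 = 6` (`drSqrt_iff_deep`); at `b = 0` the operand `15/4` slips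
(`fl_⟨9,0,…⟩ √(15/4) = 31/16 ↦ 2 ≠ 15/8 = fl_e2m3 √(15/4)`). The (U) clause of THEOREM D-sqrt gives
only `b ≥ 3`; the two disjuncts of [Roux2014, Table II] read `b ≥ 1` (= the depth test) resp.
`b ≥ 3`; the failure at `b = 0` is LAW N-sqrt-U′ (this packet). -/
theorem drSqrt_E2M3_toy9_iff {b : ℕ} (hb : b ≤ 12) : DRSqrt E2M3 (sqrtToy9 b) ↔ 1 ≤ b := by
  have hE : embedsTest E2M3 (sqrtToy9 b) = true := by
    interval_cases b <;> decide +kernel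
  have h := drSqrt_iff_deep hE (by simp [sqrtToy9, E2M3]) (by decide)
    (by simp [Format.qexp, sqrtToy9, E2M3]; omega) (by decide) (by decide) (by decide)
  rw [h]; simp [Format.qexp, sqrtToy9, E2M3]; omega

/-- The same for e2m1 through `⟨5, b, 12, 31⟩` (`P = 6 = 2·2 + 2`, embedded iff `b ≤ 10`):
innocuous iff `b ≥ 1` (`d = 3 + b ≥ m + 3 = 4`); at `b = 0`, `fl √3 = 7/4 ↦ 2 ≠ 3/2`. -/
theorem drSqrt_E2M1_toy5_iff {b : ℕ} (hb : b ≤ 10) : DRSqrt E2M1 (sqrtToy5 b) ↔ 1 ≤ b := by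
  have hE : embedsTest E2M1 (sqrtToy5 b) = true := by
    interval_cases b <;> decide +kernel
  have h := drSqrt_iff_deep hE (by simp [sqrtToy5, E2M1]) (by decide)
    (by simp [Format.qexp, sqrtToy5, E2M1]; omega) (by decide) (by decide) (by decide)
  rw [h]; simp [Format.qexp, sqrtToy5, E2M1]; omega

end Summit.Ventures.CertifiedArithmetic
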